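import Mathlib
import Summits.Ventures.PercRepro2.SevenKernel
import Summits.Ventures.PercRepro2.SevenTyped
import Summits.Ventures.PercRepro2.SevenCoverAll
import Summits.Ventures.PercRepro2.SevenCoverNine
import Summits.Ventures.PercRepro2.HCovSwap

/-!
# The seven-skeleton class as a predicate on `(ends, marks)` — for the weighted residual (blind cell PercRepro2, mine-2 g34)

`SevenSkelClass ends o a₁ a₂ a₃ b`: the graph is, up to an injective relabelling `q : Fin 7 → V` carrying the marks to
`0, 1, 2, 3, 4`, a subgraph of a seven-vertex twelve-edge skeleton `S` with a kernel certificate `Cert S`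
(`SevenKernel.lean`; the 238 certified skeletons of this generation — `hub x y`, `hub2 i j`, `covVec9 i` — and any
skeleton certified later by one `decide +kernel`).  **`HCov_of_sevenSkelClass`**: (HCOV) on the class for every
admissible weight vector (`SevenCoverAll.HCov_of_subgraph`); **`HCov_of_sevenSkelClass'`**: the same with the roots
swapped (`CovForm.HCov_swap`) — so the class, in either orientation of the roots, is one more clause of typer-1 g52's
weighted residual (`WRed.WReducedB`), like the block-substitution classes of `BlockSubstClass.lean`.  Own work;
standard axioms.
-/

namespace Summit.Ventures.PercRepro2

namespace Seven

section Class

variable {V : Type*} {E : Type*} [Fintype E] [DecidableEq E] [DecidableEq V]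

/-- **The seven-skeleton class**: the graph is a subgraph, up to an injective relabelling `q : Fin 7 → V` with
`q 0 = o, q 1 = a₁, q 2 = a₂, q 3 = a₃, q 4 = b`, of a twelve-edge skeleton `S` on seven vertices with a kernel
certificate `Cert S`. -/
def SevenSkelClass (ends : E → Sym2 V) (o a₁ a₂ a₃ b : V) : Prop :=
  ∃ (S : Fin 12 → Fin 7 × Fin 7) (q : Fin 7 → V), Cert S ∧ Function.Injective q ∧
    q 0 = o ∧ q 1 = a₁ ∧ q 2 = a₂ ∧ q 3 = a₃ ∧ q 4 = b ∧ ∀ e, ∃ j, ends e = (Seven.ends S j).map q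

variable {R : Type*} [Field R] [LinearOrder R] [IsStrictOrderedRing R]

/-- **(HCOV) on the seven-skeleton class** for every admissible weight vector. -/
theorem HCov_of_sevenSkelClass (ends : E → Sym2 V) (o a₁ a₂ a₃ b : V)
    (h : SevenSkelClass ends o a₁ a₂ a₃ b) (p : E → R) (hp : IsProbVec p) :
    CovForm.HCov p ends o a₁ a₂ a₃ b := by
  obtain ⟨S, q, hS, hq, h0, h1, h2, h3, h4, hsub⟩ := h
  rw [← h0, ← h1, ← h2, ← h3, ← h4]
  exact HCov_of_subgraph S hS ends q hq hsub p hp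

/-- **(HCOV) on the seven-skeleton class with the roots swapped**: the class at `(o, a₂, a₁, a₃, b)` gives (HCOV) at
`(o, a₁, a₂, a₃, b)` (`CovForm.HCov_swap`). -/
theorem HCov_of_sevenSkelClass' (ends : E → Sym2 V) (o a₁ a₂ a₃ b : V)
    (h : SevenSkelClass ends o a₂ a₁ a₃ b) (p : E → R) (hp : IsProbVec p) :
    CovForm.HCov p ends o a₁ a₂ a₃ b :=
  (CovForm.HCov_swap p ends o a₁ a₂ a₃ b).1 (HCov_of_sevenSkelClass ends o a₂ a₁ a₃ b h p hp)

omit [Fintype E] [DecidableEq E] [DecidableEq V] in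
/-- Every cover skeleton of THEOREM 34′ is certified: the skeletons `covVec9 i` are in the class's range. -/
theorem sevenSkelClass_of_cov9 (ends : E → Sym2 V) (o a₁ a₂ a₃ b : V) (i : Fin 183) (q : Fin 7 → V)
    (hq : Function.Injective q) (h0 : q 0 = o) (h1 : q 1 = a₁) (h2 : q 2 = a₂) (h3 : q 3 = a₃) (h4 : q 4 = b)
    (hsub : ∀ e, ∃ j, ends e = (Seven.ends (covVec9 i) j).map q) : SevenSkelClass ends o a₁ a₂ a₃ b :=
  ⟨covVec9 i, q, cert_cov9 i, hq, h0, h1, h2, h3, h4, hsub⟩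

end Class

end Seven

end Summit.Ventures.PercRepro2
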